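import Literature.AnabelianGeometry.EtaleTheta.FreeProfinitePermBasisEmbedding
import Literature.AnabelianGeometry.EtaleTheta.FreeProfinitePermBasisFree
import Literature.AnabelianGeometry.EtaleTheta.FreeProfinitePermBasisTowers
import HarnessLib

/-!
# (PBF-prime) from (PBF₀): the P-tower (PL3-TREEFREE §3.2 (iii), iso-free form), and the assembled chain
# `permBasisFixedPoints_holds` — THEOREMS ONLY (v3; no hypotheses; the tower is in `…Towers.lean`)

HONEST FRAMING. Classical profinite group theory (free profinite groups as completions of free groups, free profinite
products of finite groups as completions of free products); theorems only, no named-fact hypothesis; the four candidate `Prop`s of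
`FreeProfinitePermBasis.lean` are all PROVED in this packet (`_holds`); no (E)-class module and no `SettingModel*` file is
imported; nothing of [EtTh]/[IUTchII]/[IUTchIII] in print is asserted; CELL hextΔ/hΘ UNDECIDED-AT-MODEL; no side is taken on
[IUTchIII] Cor. 3.12; nothing here says abc is proved or refuted.  abc-iut cell, programme P-L2, rung (L3′), ROUTE-PBF,
P-chain (seat abc-iut-w6-d081 GEN 23; v3 GEN 24); desk: PL3-TREEFREE (abc-iut-L6-t19 g22) + PL3-PBF-READ (this seat).
-/

namespace Literature.AnabelianGeometry.EtaleTheta.SettingModel.TreeFree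

open CategoryTheory Topology
open Literature.IUT.HodgeTheaters (profiniteCompletion toCompletion)

universe u

/-! ## (PBF) at prime exponent ⟸ (PBF₀): the P-tower (PL3-TREEFREE §3.2 (iii), iso-free form)

For `σ` with `σ^q = 1` (`q` prime) on the finite basis `S`, `Y := S^σ`, `X′ := S ∖ Y` (as the subtype `Xp σ`),
and a finite-index normal `N ⊴ FreeGroup S`, put `P_N :=` the image of `⟨Y⟩` in `FreeGroup S / N` (finite),
`B_N := P_N × X′` with `P_N` acting by left translation on the first factor, `E_N := FreeGroup B_N ⋊ P_N`.
Homomorphisms: `π_N : FreeGroup S → E_N` (`y ↦ ȳ ∈ P_N`, `x′ ↦ (1, x′)`), `ρ_N : E_N → FreeGroup S / N`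
(`(p, x′) ↦ p x̄′ p⁻¹`, `p ↦ p`) with `ρ_N ∘ π_N = (· mod N)`; `σ` acts on `E_N` through the FREE prime-order
permutation `σ_B := id × σ|X′` of `B_N`, compatibly with `π_N`.  For `w ∈ F̂(S)` fixed by `permHat σ`, `u := π̂_N w`
is `σ̂`-fixed; `v := u · r̂_P(u)⁻¹` (`r_P := inr ∘ rightHom`) is `σ̂`-fixed and dies in `P̂_N`, hence (EXACTNESS of the
completed sequence `F̂(B_N) → Ê_N → P̂_N`, proved by shadows) `v = ĵ(v′)` with `permHat σ_B v′ = v′`, so `v′ = 1` by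
(PBF₀) and `u = r̂_P(u)`; applying `ρ̂_N`, the `N`-shadow of `w` lies in `P_N` = the `N`-shadow of `cl⟨Y⟩`.  The
ENDGAME lemma (`⋂_N cl⟨Y⟩·K_N = cl⟨Y⟩`) gives `w ∈ cl⟨Y⟩`.
-/

section PTower

variable {S : Type u}

/-- **(PBF) at prime exponent from (PBF₀)** — PL3-TREEFREE §3.2 (iii), via the P-tower and the endgame
(towers in `FreeProfinitePermBasisTowers.lean`).  Statement of the ROUTE-PBF P-chain (this packet); cf. Ribes–Zalesskii, *Profinite Groups*, §3.2. [cite: RibesZalesskii2010, §3.2] -/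
theorem permBasisFixedPointsPrime_of_free (h0 : PermBasisFixedPointsFree.{u}) : PermBasisFixedPointsPrime.{u} := by
  intro S _ σ q hq hσq w hw
  classical
  apply mem_of_forall_exists_shadow_eq isClosed_closure
  intro N
  haveI : Finite (FreeGroup S ⧸ N.toSubgroup) := Subgroup.finite_quotient_of_finiteIndex
  haveI : Finite (PN σ N) := inferInstance
  haveI : Fintype (BN σ N) := Fintype.ofFinite _
  haveI := finiteIndex_range_inl (σ := σ) (N := N)
  -- u := π̂_N w is σ̂-fixed
  set u : profiniteCompletion (EN σ N) := mapHat (piN σ N) w with hudef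
  have hu : mapHat (sigmaE σ N) u = u := by
    have h1 : mapHat (piN σ N) (mapHat (FreeGroup.map σ) w) = mapHat (sigmaE σ N) u := by
      rw [hudef, ← mapHat_comp_apply, ← mapHat_comp_apply, piN_comp_map]
    have h2 : mapHat (FreeGroup.map σ) w = permHat σ w := rfl
    rw [← h1, h2, hw]
  -- r := r̂_P u, v := u r⁻¹
  set r : profiniteCompletion (EN σ N) := mapHat (rP σ N) u with hrdef
  have hr1 : mapHat (SemidirectProduct.rightHom : EN σ N →* PN σ N) r =
      mapHat (SemidirectProduct.rightHom : EN σ N →* PN σ N) u := by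
    rw [hrdef, ← mapHat_comp_apply, rightHom_comp_rP]
  have hrσ : mapHat (sigmaE σ N) r = r := by
    rw [hrdef, ← mapHat_comp_apply, sigmaE_comp_rP, mapHat_comp_apply, hu]
  set v : profiniteCompletion (EN σ N) := u * r⁻¹ with hvdef
  have hv1 : mapHat (SemidirectProduct.rightHom : EN σ N →* PN σ N) v = 1 := by
    rw [hvdef, map_mul, map_inv, hr1, mul_inv_cancel]
  have hvσ : mapHat (sigmaE σ N) v = v := by
    rw [hvdef, map_mul, map_inv, hu, hrσ]
  -- exactness: v = ĵ v'
  have hvK := mem_closure_ker_of_mapHat_eq_one (SemidirectProduct.rightHom : EN σ N →* PN σ N) hv1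
  have hrange := range_mapHat_of_finiteIndex (SemidirectProduct.inl : FreeGroup (BN σ N) →* EN σ N)
    SemidirectProduct.inl_injective
  rw [SemidirectProduct.range_inl_eq_ker_rightHom] at hrange
  rw [← hrange] at hvK
  obtain ⟨v', hv'⟩ := hvK
  -- equivariance and injectivity of ĵ: v' is fixed by permHat σ_B
  have hequiv : mapHat (sigmaE σ N) (mapHat (SemidirectProduct.inl : FreeGroup (BN σ N) →* EN σ N) v') =
      mapHat (SemidirectProduct.inl : FreeGroup (BN σ N) →* EN σ N) (permHat (sigmaB σ N) v') := by
    rw [← mapHat_comp_apply, sigmaE, SemidirectProduct.map_comp_inl, mapHat_comp_apply, permAut_toMonoidHom]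
    rfl
  have hfix : permHat (sigmaB σ N) v' = v' := by
    apply mapHat_injective_of_finiteIndex (SemidirectProduct.inl : FreeGroup (BN σ N) →* EN σ N)
      SemidirectProduct.inl_injective
    rw [← hequiv, hv', hvσ]
  have hv'1 : v' = 1 := h0 (BN σ N) (sigmaB σ N) q hq (sigmaB_pow_eq_one hσq) sigmaB_ne v' hfix
  have hv0 : v = 1 := by rw [← hv', hv'1, map_one]
  have hur : u = r := by
    have : u * r⁻¹ = 1 := hv0
    rwa [mul_inv_eq_one] at this
  -- apply ρ̂_N
  have hρu : mapHat (rhoN σ N) u = mapHat (QuotientGroup.mk' N.toSubgroup) w := by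
    rw [hudef, ← mapHat_comp_apply, rhoN_comp_piN]
  obtain ⟨p, hp⟩ := toCompletion_surjective_of_finite (D := PN σ N)
    (mapHat (SemidirectProduct.rightHom : EN σ N →* PN σ N) u)
  have hρr : mapHat (rhoN σ N) r = toCompletion (FreeGroup S ⧸ N.toSubgroup) (p : FreeGroup S ⧸ N.toSubgroup) := by
    rw [hrdef, ← mapHat_comp_apply, rhoN_comp_rP, mapHat_comp_apply, ← hp, mapHat_toCompletion,
      Subgroup.coe_subtype]
  -- p is the class of some d ∈ ⟨Y⟩
  obtain ⟨d, hd, hdp⟩ := Subgroup.mem_map.mp p.2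
  refine ⟨toCompletion (FreeGroup S) d, subset_closure ⟨d, hd, rfl⟩, ?_⟩
  -- compare the N-shadows through `mk' N` at the level ⊥ of F(S)/N
  let B0 : FiniteIndexNormalSubgroup (FreeGroup S ⧸ N.toSubgroup) := FiniteIndexNormalSubgroup.ofSubgroup ⊥
  refine shadow_eq_of_mapHat_eq (QuotientGroup.mk' N.toSubgroup) B0 ?_ ?_
  · rw [FiniteIndexNormalSubgroup.toSubgroup_comap]
    simp [B0, MonoidHom.comap_bot, QuotientGroup.ker_mk']
  · rw [mapHat_toCompletion, ← hρu, hur, hρr]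
    congr 1


end PTower

/-! ## THE CHAIN ASSEMBLED -/

/-- **(PBF) — no hypotheses (v2)** — fixed points of a finite group of basis permutations of a free profinite group of
finite rank are (topologically) generated by the fixed letters: `PermBasisFixedPoints` ⟸ cyclic case (§3.2 (i),
`…Retractions`) ⟸ prime exponent (§3.2 (ii), `…Embedding`) ⟸ (PBF₀) (§3.2 (iii), the P-tower above) ⟸ the Kurosh-free
centraliser theorem (`FreeProfinitePermBasisCentralizer`).  The hypothesis consumed by the T-chain of (L3′) slice 1
(Thm R1 / Cor R1′ / Lemma R1b♯ ⟸ (PBF), abc-iut-L6-t19) is therefore a THEOREM.  Statement of the ROUTE-PBF P-chain (this packet); cf. Ribes–Zalesskii, *Profinite Groups*, §3.2. [cite: RibesZalesskii2010, §3.2] -/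
theorem permBasisFixedPoints_holds : PermBasisFixedPoints.{u} :=
  permBasisFixedPoints_of_cyclic
    (permBasisFixedPointsCyclic_of_prime (permBasisFixedPointsPrime_of_free permBasisFixedPointsFree_holds))

/-- `PermBasisFixedPoints` — `_holds` alias of `permBasisFixedPoints_holds` above under the fact's exact name (appended
2026-08-28, D-0026 bookkeeping: the proof term is the existing theorem of this file; no statement,
definition or attribute is edited; no new named fact; the ledger's debt table listed the fact
unproved). [cite: RibesZalesskii2010, §3.2] -/
theorem _root_.Literature.AnabelianGeometry.EtaleTheta.SettingModel.TreeFree.PermBasisFixedPoints_holds :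
    PermBasisFixedPoints.{u} :=
  _root_.Literature.AnabelianGeometry.EtaleTheta.SettingModel.TreeFree.permBasisFixedPoints_holds

/-- **(PBF-prime) — no hypotheses.**  Statement of the ROUTE-PBF P-chain (this packet); cf. Ribes–Zalesskii, *Profinite Groups*, §3.2. [cite: RibesZalesskii2010, §3.2] -/
theorem permBasisFixedPointsPrime_holds : PermBasisFixedPointsPrime.{u} :=
  permBasisFixedPointsPrime_of_free permBasisFixedPointsFree_holds

/-- `PermBasisFixedPointsPrime` — `_holds` alias of `permBasisFixedPointsPrime_holds` above under the fact's exact name (appended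
2026-08-28, D-0026 bookkeeping: the proof term is the existing theorem of this file; no statement,
definition or attribute is edited; no new named fact; the ledger's debt table listed the fact
unproved). [cite: RibesZalesskii2010, §3.2] -/
theorem _root_.Literature.AnabelianGeometry.EtaleTheta.SettingModel.TreeFree.PermBasisFixedPointsPrime_holds :
    PermBasisFixedPointsPrime.{u} :=
  _root_.Literature.AnabelianGeometry.EtaleTheta.SettingModel.TreeFree.permBasisFixedPointsPrime_holds

/-- **(PBF-cyclic) — no hypotheses.**  Statement of the ROUTE-PBF P-chain (this packet); cf. Ribes–Zalesskii, *Profinite Groups*, §3.2. [cite: RibesZalesskii2010, §3.2] -/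
theorem permBasisFixedPointsCyclic_holds : PermBasisFixedPointsCyclic.{u} :=
  permBasisFixedPointsCyclic_of_prime permBasisFixedPointsPrime_holds

/-- `PermBasisFixedPointsCyclic` — `_holds` alias of `permBasisFixedPointsCyclic_holds` above under the fact's exact name (appended
2026-08-28, D-0026 bookkeeping: the proof term is the existing theorem of this file; no statement,
definition or attribute is edited; no new named fact; the ledger's debt table listed the fact
unproved). [cite: RibesZalesskii2010, §3.2] -/
theorem _root_.Literature.AnabelianGeometry.EtaleTheta.SettingModel.TreeFree.PermBasisFixedPointsCyclic_holds :
    PermBasisFixedPointsCyclic.{u} :=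
  _root_.Literature.AnabelianGeometry.EtaleTheta.SettingModel.TreeFree.permBasisFixedPointsCyclic_holds


end Literature.AnabelianGeometry.EtaleTheta.SettingModel.TreeFree
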